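import Mathlib
import Summits.Ventures.PercRepro2.M9HarrisCube

/-!
# Harris on a cube for functions of either sign, and the one-sided tilt (blind cell PercRepro2,
p3 g25, 2026-08-28; `proofs/P3-GENERALD.md` §6)

`M9HarrisCube` gives Harris on the cube `{x ≤ c}` of a finite distributive lattice for
NON-NEGATIVE monotone functions.  Shifting by lower bounds removes the sign condition
(`card_mul_sum_mul_le'`: `|cube| · Σ f·g ≤ (Σ f)(Σ g)` for `f` monotone and `g` antitone on the
cube), and with it the inequality used by the one-sided parts of the general single-`d` sum: if
`f` is antitone with `Σ f ≥ 0` and `g` is monotone with `Σ g ≤ 0` then `Σ f·g ≤ 0`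
(`sum_mul_nonpos_of_antitone_monotone`).  The two sign conditions follow from a complement
involution `κ` of the cube with `f x + f (κ x) ≥ 0` and `g x + g (κ x) ≤ 0`
(`sum_nonneg_of_add_comp`, `sum_nonpos_of_add_comp`, `sum_mul_nonpos_of_comp`): on the cube of
the free blocks not adjacent to the `Y`-pocket of `d`, `f = σ_rs` (antitone; the block symmetry
gives `σ_rs(T) + σ_rs(Tᶜ) ≥ 0`) and `g = ŷ(H_Y) − ŷ(H_W)` (monotone; the `W`-hub structure of
`T` contains the `Y`-hub structure of `Tᶜ`, so `g(T) + g(Tᶜ) ≤ 0`).  Own work; std axioms.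
-/

namespace Summit.Ventures.PercRepro2

namespace HarrisCube

open Finset Classical

variable {α : Type*} [DistribLattice α] [Fintype α]

/-- Every function has a lower bound on the (finite, nonempty) cube. -/
lemma exists_lower_bound (c : α) (f : α → ℤ) : ∃ b : ℤ, ∀ x, x ≤ c → b ≤ f x := by
  refine ⟨(cube c).inf' (cube_nonempty c) f, fun x hx => ?_⟩
  exact Finset.inf'_le f (mem_cube.2 hx)

omit [Fintype α] in
/-- A shifted monotone function is monotone. -/
lemma monotoneOn_sub_const {c : α} {f : α → ℤ} (hf : MonotoneOn f (Set.Iic c)) (b : ℤ) :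
    MonotoneOn (fun x => f x - b) (Set.Iic c) :=
  fun x hx y hy hxy => by
    have := hf hx hy hxy
    simp only
    omega

omit [Fintype α] in
/-- A shifted antitone function is antitone. -/
lemma antitoneOn_sub_const {c : α} {f : α → ℤ} (hf : AntitoneOn f (Set.Iic c)) (b : ℤ) :
    AntitoneOn (fun x => f x - b) (Set.Iic c) :=
  fun x hx y hy hxy => by
    have := hf hx hy hxy
    simp only
    omega

/-- **Harris on the cube, either sign**: for `f` monotone and `g` antitone on `{x ≤ c}`,
`|cube c| · Σ f·g ≤ (Σ f)(Σ g)`. -/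
theorem card_mul_sum_mul_le' (c : α) {f g : α → ℤ} (hf : MonotoneOn f (Set.Iic c))
    (hg : AntitoneOn g (Set.Iic c)) :
    (cube c).card * ∑ x ∈ cube c, f x * g x ≤ (∑ x ∈ cube c, f x) * (∑ x ∈ cube c, g x) := by
  obtain ⟨a, ha⟩ := exists_lower_bound c f
  obtain ⟨b, hb⟩ := exists_lower_bound c g
  have key := card_mul_sum_mul_le c (f := fun x => f x - a) (g := fun x => g x - b)
    (fun x hx => by have := ha x hx; omega)
    (fun x hx => by have := hb x hx; omega)
    (monotoneOn_sub_const hf a) (antitoneOn_sub_const hg b)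
  have e1 : ∑ x ∈ cube c, (f x - a) * (g x - b) =
      ∑ x ∈ cube c, f x * g x - b * ∑ x ∈ cube c, f x - a * ∑ x ∈ cube c, g x +
        (cube c).card * (a * b) := by
    simp only [sub_mul, mul_sub, Finset.sum_sub_distrib, ← Finset.sum_mul, ← Finset.mul_sum,
      Finset.sum_const]
    ring
  have e2 : ∑ x ∈ cube c, (f x - a) = ∑ x ∈ cube c, f x - (cube c).card * a := by
    simp [Finset.sum_sub_distrib, Finset.sum_const]
  have e3 : ∑ x ∈ cube c, (g x - b) = ∑ x ∈ cube c, g x - (cube c).card * b := by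
    simp [Finset.sum_sub_distrib, Finset.sum_const]
  rw [e1, e2, e3] at key
  nlinarith [key]

/-- **The one-sided tilt**: an antitone `f` with non-negative sum and a monotone `g` with
non-positive sum have `Σ f·g ≤ 0` on the cube. -/
theorem sum_mul_nonpos_of_antitone_monotone (c : α) {f g : α → ℤ} (hf : AntitoneOn f (Set.Iic c))
    (hg : MonotoneOn g (Set.Iic c)) (hfs : 0 ≤ ∑ x ∈ cube c, f x)
    (hgs : ∑ x ∈ cube c, g x ≤ 0) : ∑ x ∈ cube c, f x * g x ≤ 0 := by
  have h := card_mul_sum_mul_le' c hg hf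
  have hprod : (∑ x ∈ cube c, g x) * (∑ x ∈ cube c, f x) ≤ 0 :=
    mul_nonpos_of_nonpos_of_nonneg hgs hfs
  have hcard : (0 : ℤ) < (cube c).card := by exact_mod_cast cube_card_pos c
  have hsum : ∑ x ∈ cube c, g x * f x = ∑ x ∈ cube c, f x * g x :=
    Finset.sum_congr rfl fun x _ => mul_comm _ _
  rw [hsum] at h
  by_contra hcon
  have hpos : (0 : ℤ) < ∑ x ∈ cube c, f x * g x := not_le.mp hcon
  have : (0 : ℤ) < (cube c).card * ∑ x ∈ cube c, f x * g x := mul_pos hcard hpos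
  linarith

/-- A function whose values at `x` and `κ x` sum to at least `0`, for an involution `κ` of the
cube, has non-negative sum over the cube. -/
lemma sum_nonneg_of_add_comp (c : α) {κ : α → α} (hκc : ∀ x, x ≤ c → κ x ≤ c)
    (hκκ : ∀ x, x ≤ c → κ (κ x) = x) {f : α → ℤ} (hf : ∀ x, x ≤ c → 0 ≤ f x + f (κ x)) :
    0 ≤ ∑ x ∈ cube c, f x := by
  have h1 : ∑ x ∈ cube c, f (κ x) = ∑ x ∈ cube c, f x := sum_comp_involution c hκc hκκ f
  have h2 : 0 ≤ ∑ x ∈ cube c, (f x + f (κ x)) :=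
    Finset.sum_nonneg fun x hx => hf x (mem_cube.1 hx)
  rw [Finset.sum_add_distrib, h1] at h2
  linarith

/-- A function whose values at `x` and `κ x` sum to at most `0`, for an involution `κ` of the
cube, has non-positive sum over the cube. -/
lemma sum_nonpos_of_add_comp (c : α) {κ : α → α} (hκc : ∀ x, x ≤ c → κ x ≤ c)
    (hκκ : ∀ x, x ≤ c → κ (κ x) = x) {g : α → ℤ} (hg : ∀ x, x ≤ c → g x + g (κ x) ≤ 0) :
    ∑ x ∈ cube c, g x ≤ 0 := by
  have h1 : ∑ x ∈ cube c, g (κ x) = ∑ x ∈ cube c, g x := sum_comp_involution c hκc hκκ g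
  have h2 : ∑ x ∈ cube c, (g x + g (κ x)) ≤ 0 :=
    Finset.sum_nonpos fun x hx => hg x (mem_cube.1 hx)
  rw [Finset.sum_add_distrib, h1] at h2
  linarith

/-- **The one-sided tilt with a complement involution**: `f` antitone with `f x + f (κ x) ≥ 0`,
`g` monotone with `g x + g (κ x) ≤ 0`, `κ` an involution of the cube ⟹ `Σ f·g ≤ 0`. -/
theorem sum_mul_nonpos_of_comp (c : α) {κ : α → α} (hκc : ∀ x, x ≤ c → κ x ≤ c)
    (hκκ : ∀ x, x ≤ c → κ (κ x) = x) {f g : α → ℤ} (hf : AntitoneOn f (Set.Iic c))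
    (hg : MonotoneOn g (Set.Iic c)) (hfκ : ∀ x, x ≤ c → 0 ≤ f x + f (κ x))
    (hgκ : ∀ x, x ≤ c → g x + g (κ x) ≤ 0) : ∑ x ∈ cube c, f x * g x ≤ 0 :=
  sum_mul_nonpos_of_antitone_monotone c hf hg (sum_nonneg_of_add_comp c hκc hκκ hfκ)
    (sum_nonpos_of_add_comp c hκc hκκ hgκ)

end HarrisCube

end Summit.Ventures.PercRepro2
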